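import Literature.Analysis.PDE.PatchResidualEnergy
import Literature.Analysis.PDE.SlabSolutionEstimates
import Literature.Analysis.PDE.SlabEnergyBounds
import HarnessLib

/-!
# The linear a priori estimate on a closed manifold: weighted patch energies of a solution are
# controlled by those of its source (topic `Analysis/PDE`)

Layer (II) of the programme to prove short-time existence for quasilinear strictly parabolic
systems on a closed manifold (hypothesis `hQL` of
`Literature.Geometry.Riemannian.ricciFlow_shortTime_existence_of_quasilinear`). Setting: a patch
system `P` on `M` (model `E'`, Euclidean), a time horizon `T > 0`, per-patch coefficient fields
`S p` (symbol operators, within `η` of the identity on the patch), `𝔟 p`, `𝔠 p` smooth on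
`[0, T] × target`, and a time-dependent function `v` on `M` with `v(0) = 0` whose chart
expressions are smooth on `[0, T] × target` and satisfy there the chart form of a linear
parabolic system with scalar principal symbol,

  `∂ₜ v̂_p = frameOp (S p t y) (𝔟 p t y) (𝔠 p t y) v̂_p + ĝ_p`   (`∂ₜ` within `[0, T]`).

For the cut-off own-chart expressions `w_p(t) = cutExpr P p (v t)` this file proves, for every
order `i`, the existence of `Λ, C < ∞` (depending on `P`, `T`, the coefficient fields, `i` — NOT
on `v`, `g`) such that for `λ ≥ Λ`, `t ∈ [0, T]`:

  `Σ_p ∫₀ᵗ e^{-2λs} E_i(∂ₜw_p - Δw_p) ds ≤ C Σ_p ∫₀ᵗ e^{-2λs} E_i(cutExpr P p (g s)) ds`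

(`linear_apriori_residual_le`), from which all weighted patch energies of `v` follow by the
a priori estimates of `SlabSolutionEstimates.lean` (`linear_apriori_energy_le`). The proof:
the per-time energy split of the residual (`PatchResidualEnergy.lean`: top order same patch
with the small factor `η²`, lower order through all patches), integration in time, the engine
bounds for `w_p` (maximal regularity `n`, gains `λ⁻¹/2`, `λ⁻²`), and absorption; the only
smallness of the geometry is `16 n⁴ η² ≤ 1`, level-independent.

Everything is proved; no named fact and no `sorry` is introduced.

## References

* L. C. Evans, *Partial Differential Equations*, 2nd ed., AMS 2010, §7.1.2–§7.1.3 (energy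
  estimates for linear parabolic equations; a priori form, absorption of lower-order terms).
  [Evans2010]
-/

noncomputable section

open Set Function Filter Topology Metric MeasureTheory InnerProductSpace
open scoped Manifold ContDiff Topology ENNReal RealInnerProductSpace Laplacian

namespace Literature.Analysis.PDE

open Literature.Geometry.Manifold Literature.Analysis.FunctionSpaces Literature.Analysis.FluidPDE

variable {E : Type*} [NormedAddCommGroup E] [NormedSpace ℝ E] {H : Type*} [TopologicalSpace H]
variable {I : ModelWithCorners ℝ E H} {M : Type*} [TopologicalSpace M] [ChartedSpace H M]
variable {E' : Type*} [NormedAddCommGroup E'] [InnerProductSpace ℝ E'] [FiniteDimensional ℝ E']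
variable {F' : Type*} [NormedAddCommGroup F'] [InnerProductSpace ℝ F']
variable {ι : Type*} [Fintype ι] (P : PatchSystem I M E' ι)

namespace PatchSystemLoc

/-! ### Slab smoothness of cut-off products -/

section Slab

variable {X : Type*} [NormedAddCommGroup X] [NormedSpace ℝ X]

omit [FiniteDimensional ℝ E'] in
/-- **Slab smoothness of a cut-off product**: for `χ` smooth with `tsupport χ ⊆ V`, `V` open, and
`G` smooth on `S ×ˢ V`, the product `(s, y) ↦ χ y • G s y` is smooth on `S ×ˢ univ`. [folklore] -/
theorem contDiffOn_slab_smul_of_tsupport_subset {V : Set E'} (hV : IsOpen V) {χ : E' → ℝ}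
    (hχ : ContDiff ℝ ∞ χ) (hχV : tsupport χ ⊆ V) {S : Set ℝ} {G : ℝ → E' → X}
    (hG : ContDiffOn ℝ ∞ (uncurry G) (S ×ˢ V)) :
    ContDiffOn ℝ ∞ (uncurry fun s y ↦ χ y • G s y) (S ×ˢ univ) := by
  rintro ⟨s, y⟩ hsy
  have hs : s ∈ S := (mem_prod.1 hsy).1
  by_cases hy : y ∈ V
  · -- near `(s, y)` within the slab the product is a product of smooth functions
    have h1 : ContDiffOn ℝ ∞ (uncurry fun s y ↦ χ y • G s y) (S ×ˢ V) :=
      ((hχ.comp contDiff_snd).contDiffOn).smul hG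
    refine (h1 (s, y) (mk_mem_prod hs hy)).mono_of_mem_nhdsWithin ?_
    refine mem_nhdsWithin.2 ⟨univ ×ˢ V, isOpen_univ.prod hV, mk_mem_prod (mem_univ _) hy, ?_⟩
    rintro ⟨s', y'⟩ ⟨h1, h2⟩
    exact mk_mem_prod (mem_prod.1 h2).1 (mem_prod.1 h1).2
  · -- off `V` the product vanishes near `(s, y)`
    have hy' : y ∉ tsupport χ := fun h ↦ hy (hχV h)
    obtain ⟨U, hU, hyU, hU0⟩ : ∃ U : Set E', IsOpen U ∧ y ∈ U ∧ ∀ z ∈ U, χ z = 0 := by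
      refine ⟨(tsupport χ)ᶜ, (isClosed_tsupport χ).isOpen_compl, hy', fun z hz ↦ ?_⟩
      exact image_eq_zero_of_notMem_tsupport hz
    have hev : (uncurry fun s y ↦ χ y • G s y) =ᶠ[𝓝 (s, y)] fun _ ↦ 0 := by
      filter_upwards [(isOpen_univ.prod hU).mem_nhds (mk_mem_prod (mem_univ s) hyU)] with q hq
      simp [uncurry, hU0 q.2 (mem_prod.1 hq).2]
    exact ((contDiffAt_const (c := (0 : X))).congr_of_eventuallyEq hev).contDiffWithinAt

end Slab

/-! ### Word derivatives of slab fields with values in a normed space -/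

section Words

variable {X : Type*} [NormedAddCommGroup X] [NormedSpace ℝ X] {T : ℝ}

omit [FiniteDimensional ℝ E'] in
/-- Frame word derivatives of a slab-smooth field (any normed codomain) are slab-smooth.
[folklore] -/
theorem isSmoothSpaceTimeOn_iterDirDeriv_Icc' (hT : 0 < T) {f : ℝ → E' → X}
    (hf : IsSmoothSpaceTimeOn (Icc 0 T) f) :
    ∀ β : List E', IsSmoothSpaceTimeOn (Icc 0 T) fun t ↦ iterDirDeriv β (f t)
  | [] => hf
  | v :: β => by
    have ih := isSmoothSpaceTimeOn_iterDirDeriv_Icc' hT hf β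
    exact (ih.fderiv_slice (uniqueDiffOn_Icc hT)).clm_apply (isSmoothSpaceTimeOn_const_time contDiff_const _)

omit [InnerProductSpace ℝ E'] [FiniteDimensional ℝ E'] in
/-- Word derivatives do not enlarge the topological support. [folklore] -/
theorem tsupport_iterDirDeriv_subset [NormedSpace ℝ E'] (g : E' → X) :
    ∀ β : List E', tsupport (iterDirDeriv β g) ⊆ tsupport g
  | [] => Subset.rfl
  | v :: β => (tsupport_fderiv_apply_subset ℝ v).trans (tsupport_iterDirDeriv_subset g β)

omit [FiniteDimensional ℝ E'] in
/-- **Uniform bounds of word derivatives of a slab field vanishing off a compact set** (any normed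
codomain): continuity on the compact `[0, T] × K`. [folklore] -/
theorem exists_bound_iterDirDeriv_slab' (hT : 0 < T) {f : ℝ → E' → X} (hf : IsSmoothSpaceTimeOn (Icc 0 T) f)
    {K : Set E'} (hK : IsCompact K) (hfK : ∀ s, ∀ y ∉ K, f s y = 0) (β : List E') :
    ∃ C : ℝ, 0 ≤ C ∧ ∀ s ∈ Icc 0 T, ∀ y, ‖iterDirDeriv β (f s) y‖ ≤ C := by
  have hc : ContinuousOn (fun q : ℝ × E' ↦ iterDirDeriv β (f q.1) q.2) (Icc 0 T ×ˢ univ) :=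
    (isSmoothSpaceTimeOn_iterDirDeriv_Icc' hT hf β).continuousOn
  obtain ⟨C, hC⟩ := (isCompact_Icc.prod hK).exists_bound_of_continuousOn
    (hc.mono (prod_mono Subset.rfl (subset_univ _)))
  refine ⟨max C 0, le_max_right _ _, fun s hs y ↦ ?_⟩
  by_cases hy : y ∈ K
  · exact (hC (s, y) (mk_mem_prod hs hy)).trans (le_max_left _ _)
  · have hts : tsupport (f s) ⊆ K := by
      refine closure_minimal (fun z hz ↦ ?_) hK.isClosed
      by_contra h
      exact hz (hfK s z h)
    have h0 : iterDirDeriv β (f s) y = 0 :=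
      image_eq_zero_of_notMem_tsupport fun h ↦ hy (hts (tsupport_iterDirDeriv_subset (f s) β h))
    rw [h0, norm_zero]
    exact le_max_right _ _

end Words


/-! ### The cut-off chart expressions of a time-dependent function -/

section Family

variable [I.Boundaryless] {T : ℝ} {v : ℝ → M → F'}

/-- **The cut-off own-chart expressions of a function with slab-smooth chart expressions are
slab-smooth on the model.** [folklore] -/
theorem isSmoothSpaceTimeOn_cutExpr (p : ι)
    (hv : ContDiffOn ℝ ∞ (uncurry fun s y ↦ v s ((P.chart p).inv y)) (Icc 0 T ×ˢ (P.chart p).target)) :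
    IsSmoothSpaceTimeOn (Icc 0 T) fun s ↦ cutExpr P p (v s) := by
  have h := contDiffOn_slab_smul_of_tsupport_subset (P.chart p).isOpen_target (P.cut p).contDiff
    (P.tsupport_cut_subset p) hv
  refine (h.congr fun q _ ↦ ?_)
  obtain ⟨s, y⟩ := q
  simp only [uncurry_apply_pair]
  rw [cutExpr_eq_smul]

omit [I.Boundaryless] in
/-- The family vanishes off the compact ball `closedBall 0 (3rₚ)`. [folklore] -/
theorem cutExpr_family_eq_zero (p : ι) (s : ℝ) {y : E'} (hy : y ∉ closedBall (0 : E') (3 * P.r p)) :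
    cutExpr P p (v s) y = 0 :=
  cutExpr_eq_zero P (v s) fun h ↦ hy (ball_subset_closedBall h)

omit [I.Boundaryless] in
/-- The family vanishes at `t = 0` when `v(0) = 0`. [folklore] -/
theorem cutExpr_family_zero (p : ι) (hv0 : ∀ x, v 0 x = 0) (y : E') : cutExpr P p (v 0) y = 0 := by
  rw [cutExpr_eq_smul]
  simp [hv0]

omit [I.Boundaryless] in
/-- **The time derivative of the cut-off expression** (within `[0, T]`):
`∂ₜ w_p = cut • ∂ₜ v̂_p` at `s ∈ [0, T]`, everywhere in `y`. [folklore] -/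
theorem timeDerivWithin_cutExpr (p : ι)
    (hv : ContDiffOn ℝ ∞ (uncurry fun s y ↦ v s ((P.chart p).inv y)) (Icc 0 T ×ˢ (P.chart p).target))
    {s : ℝ} (hs : s ∈ Icc 0 T) (y : E') :
    timeDerivWithin (Icc 0 T) (fun s ↦ cutExpr P p (v s)) s y =
      P.cut p y • timeDerivWithin (Icc 0 T) (fun s y ↦ v s ((P.chart p).inv y)) s y := by
  simp only [timeDerivWithin_apply, cutExpr_eq_smul]
  by_cases hy : y ∈ (P.chart p).target
  · refine derivWithin_fun_const_smul (P.cut p y) ?_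
    have hc : ContDiffWithinAt ℝ ∞ (uncurry fun s y ↦ v s ((P.chart p).inv y)) (Icc 0 T ×ˢ (P.chart p).target)
        (s, y) := hv (s, y) (mk_mem_prod hs hy)
    have hline : ContDiffWithinAt ℝ ∞ (fun s : ℝ ↦ ((s, y) : ℝ × E')) (Icc 0 T) s :=
      (contDiff_id.prodMk contDiff_const).contDiffWithinAt
    have h := hc.comp s hline (fun s' hs' ↦ mk_mem_prod hs' hy)
    exact h.differentiableWithinAt (by simp)
  · have h0 : P.cut p y = 0 := image_eq_zero_of_notMem_tsupport fun h ↦ hy (P.tsupport_cut_subset p h)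
    simp [h0]

/-- The time derivative of the cut-off expression is a smooth function of `y`. [folklore] -/
theorem contDiff_timeDerivWithin_cutExpr (hT : 0 < T) (p : ι)
    (hv : ContDiffOn ℝ ∞ (uncurry fun s y ↦ v s ((P.chart p).inv y)) (Icc 0 T ×ˢ (P.chart p).target))
    {s : ℝ} (hs : s ∈ Icc 0 T) :
    ContDiff ℝ ∞ fun y ↦ P.cut p y • timeDerivWithin (Icc 0 T) (fun s y ↦ v s ((P.chart p).inv y)) s y := by
  have h := ((isSmoothSpaceTimeOn_cutExpr P p hv).timeDerivWithin (uniqueDiffOn_Icc hT)).contDiff_slice hs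
  have heq : (fun y ↦ P.cut p y • timeDerivWithin (Icc 0 T) (fun s y ↦ v s ((P.chart p).inv y)) s y) =
      timeDerivWithin (Icc 0 T) (fun s ↦ cutExpr P p (v s)) s :=
    funext fun y ↦ (timeDerivWithin_cutExpr P p hv hs y).symm
  rw [heq]
  exact h

omit [I.Boundaryless] in
/-- **The residual of the cut-off expression at a time slice**:
`(∂ₜw_p - Δw_p)(s) = cut • ∂ₜv̂_p(s) - Δ(w_p(s))`. [folklore] -/
theorem slabResidual_cutExpr_eq (p : ι)
    (hv : ContDiffOn ℝ ∞ (uncurry fun s y ↦ v s ((P.chart p).inv y)) (Icc 0 T ×ˢ (P.chart p).target))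
    {s : ℝ} (hs : s ∈ Icc 0 T) :
    slabResidual 1 T (fun s ↦ cutExpr P p (v s)) s =
      fun y ↦ P.cut p y • timeDerivWithin (Icc 0 T) (fun s y ↦ v s ((P.chart p).inv y)) s y -
        (Δ (cutExpr P p (v s))) y := by
  funext y
  rw [slabResidual_apply, one_smul, timeDerivWithin_cutExpr P p hv hs y]

end Family

/-! ### The coefficient slab fields and their uniform bounds -/

section Coeff

variable [I.Boundaryless] {T : ℝ}

/-- The cut-off top coefficients of slab-smooth symbol fields are slab-smooth. [folklore] -/
theorem isSmoothSpaceTimeOn_topCoeff (p : ι) {S : ℝ → E' → (E' →L[ℝ] E')}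
    (hS : ContDiffOn ℝ ∞ (uncurry S) (Icc 0 T ×ˢ (P.chart p).target)) (k l : Fin (Module.finrank ℝ E')) :
    IsSmoothSpaceTimeOn (Icc 0 T) fun s y ↦ topCoeff P p (S s) k l y := by
  have hG : ContDiffOn ℝ ∞ (uncurry fun s y ↦
      ⟪stdOrthonormalBasis ℝ E' k, (S s y - 1) (stdOrthonormalBasis ℝ E' l)⟫)
      (Icc 0 T ×ˢ (P.chart p).target) :=
    contDiffOn_const.inner ℝ ((hS.sub contDiffOn_const).clm_apply contDiffOn_const)
  have h := contDiffOn_slab_smul_of_tsupport_subset (P.chart p).isOpen_target (P.cutPlus p).contDiff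
    (P.tsupport_cutPlus_subset p) hG
  exact h.congr fun q _ ↦ rfl

/-- The cut-off first-order coefficients of slab-smooth fields are slab-smooth. [folklore] -/
theorem isSmoothSpaceTimeOn_firstCoeff (p : ι) {𝔟 : ℝ → E' → ((E' →L[ℝ] F') →L[ℝ] F')}
    (h𝔟 : ContDiffOn ℝ ∞ (uncurry 𝔟) (Icc 0 T ×ˢ (P.chart p).target)) (l : Fin (Module.finrank ℝ E')) :
    IsSmoothSpaceTimeOn (Icc 0 T) fun s y ↦ firstCoeff P p (𝔟 s) l y := by
  have hG : ContDiffOn ℝ ∞ (uncurry fun s y ↦ (𝔟 s y).comp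
      (ContinuousLinearMap.smulRightL ℝ E' F' (innerSL ℝ (stdOrthonormalBasis ℝ E' l))))
      (Icc 0 T ×ˢ (P.chart p).target) :=
    h𝔟.clm_comp contDiffOn_const
  exact contDiffOn_slab_smul_of_tsupport_subset (P.chart p).isOpen_target (P.cutPlus p).contDiff
    (P.tsupport_cutPlus_subset p) hG

/-- The cut-off zeroth-order coefficient of a slab-smooth field is slab-smooth. [folklore] -/
theorem isSmoothSpaceTimeOn_zeroCoeff (p : ι) {𝔠 : ℝ → E' → (F' →L[ℝ] F')}
    (h𝔠 : ContDiffOn ℝ ∞ (uncurry 𝔠) (Icc 0 T ×ˢ (P.chart p).target)) :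
    IsSmoothSpaceTimeOn (Icc 0 T) fun s y ↦ zeroCoeff P p (𝔠 s) y :=
  contDiffOn_slab_smul_of_tsupport_subset (P.chart p).isOpen_target (P.cutPlus p).contDiff
    (P.tsupport_cutPlus_subset p) h𝔠

omit [I.Boundaryless] in
/-- The cut-off coefficient fields vanish off `closedBall 0 (4rₚ)`. [folklore] -/
theorem topCoeff_eq_zero (p : ι) (Ss : E' → (E' →L[ℝ] E')) (k l : Fin (Module.finrank ℝ E')) {y : E'}
    (hy : y ∉ closedBall (0 : E') (4 * P.r p)) : topCoeff P p Ss k l y = 0 := by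
  rw [topCoeff_apply, (P.cutPlus p).zero_of_le_dist (by simpa [P.cutPlus_rOut] using (not_le.1 (by
    simpa [mem_closedBall, dist_zero_right] using hy)).le), zero_mul]

omit [I.Boundaryless] in
/-- The cut-off first-order coefficients vanish off `closedBall 0 (4rₚ)`. [folklore] -/
theorem firstCoeff_eq_zero (p : ι) (𝔟s : E' → ((E' →L[ℝ] F') →L[ℝ] F')) (l : Fin (Module.finrank ℝ E'))
    {y : E'} (hy : y ∉ closedBall (0 : E') (4 * P.r p)) : firstCoeff P p 𝔟s l y = 0 := by
  have h0 : P.cutPlus p y = 0 := (P.cutPlus p).zero_of_le_dist (by simpa [P.cutPlus_rOut] using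
    (not_le.1 (by simpa [mem_closedBall, dist_zero_right] using hy)).le)
  simp [firstCoeff, h0]

omit [I.Boundaryless] in
/-- The cut-off zeroth-order coefficient vanishes off `closedBall 0 (4rₚ)`. [folklore] -/
theorem zeroCoeff_eq_zero (p : ι) (𝔠s : E' → (F' →L[ℝ] F')) {y : E'}
    (hy : y ∉ closedBall (0 : E') (4 * P.r p)) : zeroCoeff P p 𝔠s y = 0 := by
  have h0 : P.cutPlus p y = 0 := (P.cutPlus p).zero_of_le_dist (by simpa [P.cutPlus_rOut] using
    (not_le.1 (by simpa [mem_closedBall, dist_zero_right] using hy)).le)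
  simp [zeroCoeff, h0]

omit [I.Boundaryless] in
/-- **The top coefficient is `η`-small** when the symbol is within `η` of the identity on the
patch. [folklore] -/
theorem abs_topCoeff_le (p : ι) {Ss : E' → (E' →L[ℝ] E')} {η : ℝ} (hη : 0 ≤ η)
    (hS : ∀ y ∈ closedBall (0 : E') (4 * P.r p), ‖Ss y - 1‖ ≤ η) (k l : Fin (Module.finrank ℝ E'))
    (y : E') : |topCoeff P p Ss k l y| ≤ η := by
  by_cases hy : y ∈ closedBall (0 : E') (4 * P.r p)
  · rw [topCoeff_apply, abs_mul]
    have h1 : |P.cutPlus p y| ≤ 1 := by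
      rw [abs_of_nonneg (P.cutPlus p).nonneg]; exact (P.cutPlus p).le_one
    have h2 : |⟪stdOrthonormalBasis ℝ E' k, (Ss y - 1) (stdOrthonormalBasis ℝ E' l)⟫| ≤ η := by
      refine (abs_real_inner_le_norm _ _).trans ?_
      rw [(stdOrthonormalBasis ℝ E').orthonormal.1 k, one_mul]
      refine (ContinuousLinearMap.le_opNorm _ _).trans ?_
      rw [(stdOrthonormalBasis ℝ E').orthonormal.1 l, mul_one]
      exact hS y hy
    calc |P.cutPlus p y| * |⟪stdOrthonormalBasis ℝ E' k, (Ss y - 1) (stdOrthonormalBasis ℝ E' l)⟫|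
        ≤ 1 * η := mul_le_mul h1 h2 (abs_nonneg _) zero_le_one
      _ = η := one_mul η
  · rw [topCoeff_eq_zero P p Ss k l hy, abs_zero]
    exact hη

/-- **Uniform bounds of the cut-off coefficient fields and their word derivatives** on the slab:
a single constant `Mc` bounding, for all `s ∈ [0, T]`, all `|aₖₗ|`, `‖B_l‖`, `‖C‖` and all their
frame word derivatives of length `≤ i`. [folklore] -/
theorem exists_coeff_bound (hT : 0 < T) (p : ι) (i : ℕ) {S : ℝ → E' → (E' →L[ℝ] E')}
    {𝔟 : ℝ → E' → ((E' →L[ℝ] F') →L[ℝ] F')} {𝔠 : ℝ → E' → (F' →L[ℝ] F')}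
    (hS : ContDiffOn ℝ ∞ (uncurry S) (Icc 0 T ×ˢ (P.chart p).target))
    (h𝔟 : ContDiffOn ℝ ∞ (uncurry 𝔟) (Icc 0 T ×ˢ (P.chart p).target))
    (h𝔠 : ContDiffOn ℝ ∞ (uncurry 𝔠) (Icc 0 T ×ˢ (P.chart p).target)) :
    ∃ Mc : ℝ, 0 ≤ Mc ∧ ∀ s ∈ Icc 0 T,
      (∀ k l y, |topCoeff P p (S s) k l y| ≤ Mc) ∧
      (∀ k l, ∀ lst : List (Fin (Module.finrank ℝ E')), lst ≠ [] → lst.length ≤ i →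
        ∀ y, ‖iterDirDeriv (lst.map (stdOrthonormalBasis ℝ E')) (topCoeff P p (S s) k l) y‖ ≤ Mc) ∧
      (∀ l y, ‖firstCoeff P p (𝔟 s) l y‖ ≤ Mc) ∧
      (∀ l, ∀ lst : List (Fin (Module.finrank ℝ E')), lst ≠ [] → lst.length ≤ i →
        ∀ y, ‖iterDirDeriv (lst.map (stdOrthonormalBasis ℝ E')) (firstCoeff P p (𝔟 s) l) y‖ ≤ Mc) ∧
      (∀ y, ‖zeroCoeff P p (𝔠 s) y‖ ≤ Mc) ∧
      (∀ lst : List (Fin (Module.finrank ℝ E')), lst ≠ [] → lst.length ≤ i →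
        ∀ y, ‖iterDirDeriv (lst.map (stdOrthonormalBasis ℝ E')) (zeroCoeff P p (𝔠 s)) y‖ ≤ Mc) := by
  classical
  obtain ⟨K, hKdef⟩ : ∃ K : Set E', K = closedBall (0 : E') (4 * P.r p) := ⟨_, rfl⟩
  have hK : IsCompact K := by rw [hKdef]; exact isCompact_closedBall _ _
  -- the finite set of words of length `≤ i`
  obtain ⟨L, hL⟩ : ∃ L : Finset (List (Fin (Module.finrank ℝ E'))),
      L = (List.finite_length_le (Fin (Module.finrank ℝ E')) i).toFinset := ⟨_, rfl⟩
  have hmemL : ∀ lst : List (Fin (Module.finrank ℝ E')), lst.length ≤ i → lst ∈ L := fun lst h ↦ by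
    rw [hL, Set.Finite.mem_toFinset]; exact h
  -- the slab fields
  have hA : ∀ k l, IsSmoothSpaceTimeOn (Icc 0 T) fun s y ↦ topCoeff P p (S s) k l y :=
    isSmoothSpaceTimeOn_topCoeff P p hS
  have hB : ∀ l, IsSmoothSpaceTimeOn (Icc 0 T) fun s y ↦ firstCoeff P p (𝔟 s) l y :=
    isSmoothSpaceTimeOn_firstCoeff P p h𝔟
  have hC : IsSmoothSpaceTimeOn (Icc 0 T) fun s y ↦ zeroCoeff P p (𝔠 s) y := isSmoothSpaceTimeOn_zeroCoeff P p h𝔠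
  have hA0 : ∀ k l s, ∀ y ∉ K, topCoeff P p (S s) k l y = 0 := fun k l s y hy ↦
    topCoeff_eq_zero P p (S s) k l (by rwa [hKdef] at hy)
  have hB0 : ∀ l s, ∀ y ∉ K, firstCoeff P p (𝔟 s) l y = 0 := fun l s y hy ↦
    firstCoeff_eq_zero P p (𝔟 s) l (by rwa [hKdef] at hy)
  have hC0 : ∀ s, ∀ y ∉ K, zeroCoeff P p (𝔠 s) y = 0 := fun s y hy ↦
    zeroCoeff_eq_zero P p (𝔠 s) (by rwa [hKdef] at hy)
  -- bounds for every word
  have bA : ∀ k l (lst : List (Fin (Module.finrank ℝ E'))), ∃ C : ℝ, 0 ≤ C ∧ ∀ s ∈ Icc 0 T, ∀ y,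
      ‖iterDirDeriv (lst.map (stdOrthonormalBasis ℝ E')) (fun y ↦ topCoeff P p (S s) k l y) y‖ ≤ C :=
    fun k l lst ↦ exists_bound_iterDirDeriv_slab' hT (hA k l) hK (hA0 k l) (lst.map (stdOrthonormalBasis ℝ E'))
  have bB : ∀ l (lst : List (Fin (Module.finrank ℝ E'))), ∃ C : ℝ, 0 ≤ C ∧ ∀ s ∈ Icc 0 T, ∀ y,
      ‖iterDirDeriv (lst.map (stdOrthonormalBasis ℝ E')) (fun y ↦ firstCoeff P p (𝔟 s) l y) y‖ ≤ C :=
    fun l lst ↦ exists_bound_iterDirDeriv_slab' hT (hB l) hK (hB0 l) (lst.map (stdOrthonormalBasis ℝ E'))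
  have bC : ∀ lst : List (Fin (Module.finrank ℝ E')), ∃ C : ℝ, 0 ≤ C ∧ ∀ s ∈ Icc 0 T, ∀ y,
      ‖iterDirDeriv (lst.map (stdOrthonormalBasis ℝ E')) (fun y ↦ zeroCoeff P p (𝔠 s) y) y‖ ≤ C :=
    fun lst ↦ exists_bound_iterDirDeriv_slab' hT hC hK hC0 (lst.map (stdOrthonormalBasis ℝ E'))
  choose CA hCA0 hCA using bA
  choose CB hCB0 hCB using bB
  choose CC hCC0 hCC using bC
  -- the total constant: sum over all words in `L` (including the empty word for the sup bounds)
  obtain ⟨SA, hSA⟩ : ∃ SA : ℝ, SA = ∑ k, ∑ l, ∑ lst ∈ L, CA k l lst := ⟨_, rfl⟩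
  obtain ⟨SB, hSB⟩ : ∃ SB : ℝ, SB = ∑ l, ∑ lst ∈ L, CB l lst := ⟨_, rfl⟩
  obtain ⟨SC, hSC⟩ : ∃ SC : ℝ, SC = ∑ lst ∈ L, CC lst := ⟨_, rfl⟩
  have hSA0 : 0 ≤ SA := by
    rw [hSA]
    exact Finset.sum_nonneg fun _ _ ↦ Finset.sum_nonneg fun _ _ ↦ Finset.sum_nonneg fun _ _ ↦ hCA0 _ _ _
  have hSB0 : 0 ≤ SB := by
    rw [hSB]; exact Finset.sum_nonneg fun _ _ ↦ Finset.sum_nonneg fun _ _ ↦ hCB0 _ _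
  have hSC0 : 0 ≤ SC := by
    rw [hSC]; exact Finset.sum_nonneg fun _ _ ↦ hCC0 _
  have leA : ∀ k l lst, lst ∈ L → CA k l lst ≤ SA + SB + SC := by
    intro k l lst hlst
    have h1 : CA k l lst ≤ ∑ lst ∈ L, CA k l lst :=
      Finset.single_le_sum (f := fun lst ↦ CA k l lst) (fun _ _ ↦ hCA0 k l _) hlst
    have h2 : ∑ lst ∈ L, CA k l lst ≤ ∑ l, ∑ lst ∈ L, CA k l lst :=
      Finset.single_le_sum (f := fun l ↦ ∑ lst ∈ L, CA k l lst)
        (fun _ _ ↦ Finset.sum_nonneg fun _ _ ↦ hCA0 k _ _) (Finset.mem_univ l)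
    have h3 : ∑ l, ∑ lst ∈ L, CA k l lst ≤ SA := by
      rw [hSA]
      exact Finset.single_le_sum (f := fun k ↦ ∑ l, ∑ lst ∈ L, CA k l lst)
        (fun _ _ ↦ Finset.sum_nonneg fun _ _ ↦ Finset.sum_nonneg fun _ _ ↦ hCA0 _ _ _) (Finset.mem_univ k)
    linarith
  have leB : ∀ l lst, lst ∈ L → CB l lst ≤ SA + SB + SC := by
    intro l lst hlst
    have h1 : CB l lst ≤ ∑ lst ∈ L, CB l lst :=
      Finset.single_le_sum (f := fun lst ↦ CB l lst) (fun _ _ ↦ hCB0 l _) hlst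
    have h2 : ∑ lst ∈ L, CB l lst ≤ SB := by
      rw [hSB]
      exact Finset.single_le_sum (f := fun l ↦ ∑ lst ∈ L, CB l lst)
        (fun _ _ ↦ Finset.sum_nonneg fun _ _ ↦ hCB0 _ _) (Finset.mem_univ l)
    linarith
  have leC : ∀ lst, lst ∈ L → CC lst ≤ SA + SB + SC := by
    intro lst hlst
    have h1 : CC lst ≤ SC := by
      rw [hSC]; exact Finset.single_le_sum (f := fun lst ↦ CC lst) (fun _ _ ↦ hCC0 _) hlst
    linarith
  have h0L : ([] : List (Fin (Module.finrank ℝ E'))) ∈ L := hmemL [] (by simp)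
  refine ⟨SA + SB + SC, by linarith, fun s hs ↦ ⟨fun k l y ↦ ?_, fun k l lst _ hlen y ↦ ?_, fun l y ↦ ?_,
    fun l lst _ hlen y ↦ ?_, fun y ↦ ?_, fun lst _ hlen y ↦ ?_⟩⟩
  · have h := hCA k l [] s hs y
    simp only [List.map_nil, iterDirDeriv_nil, Real.norm_eq_abs] at h
    exact h.trans (leA k l [] h0L)
  · exact (hCA k l lst s hs y).trans (leA k l lst (hmemL lst hlen))
  · have h := hCB l [] s hs y
    simp only [List.map_nil, iterDirDeriv_nil] at h
    exact h.trans (leB l [] h0L)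
  · exact (hCB l lst s hs y).trans (leB l lst (hmemL lst hlen))
  · have h := hCC [] s hs y
    simp only [List.map_nil, iterDirDeriv_nil] at h
    exact h.trans (leC [] h0L)
  · exact (hCC lst s hs y).trans (leC lst (hmemL lst hlen))

end Coeff

/-! ### The per-time energy inequality for the residual of a patch -/

section PerTime

variable [IsManifold I ∞ M] [I.Boundaryless] [T2Space M] [MeasurableSpace E'] [BorelSpace E'] {T : ℝ}

/-- **Per-time energy inequality for the residual of a patch** (coefficient fields fixed,
`ε = 1`): there are finite `A₂, A₃, A₄` such that for every `v`, `g` with slab-smooth chart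
expressions satisfying the chart form of the system in the patch `p`, and every `s ∈ [0, T]`,
`E_i(∂ₜw_p - Δw_p) ≤ 4n²η² Σₖₗ E_i(∂ₖ∂ₗw_p) + A₂ Σₗ E_i(∂ₗw_p)
  + A₃ Σ_q (E_i(w_q) + Σ_m E_i(∂_m w_q)) + A₄ E_i(cutExpr P p (g s))` (all at time `s`).
[cite: Evans2010, §7.1.3] -/
theorem sobolevEnergy_slabResidual_le (hT : 0 < T) (p : ι) (i : ℕ) {S : ℝ → E' → (E' →L[ℝ] E')}
    {𝔟 : ℝ → E' → ((E' →L[ℝ] F') →L[ℝ] F')} {𝔠 : ℝ → E' → (F' →L[ℝ] F')}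
    (hS : ContDiffOn ℝ ∞ (uncurry S) (Icc 0 T ×ˢ (P.chart p).target))
    (h𝔟 : ContDiffOn ℝ ∞ (uncurry 𝔟) (Icc 0 T ×ˢ (P.chart p).target))
    (h𝔠 : ContDiffOn ℝ ∞ (uncurry 𝔠) (Icc 0 T ×ˢ (P.chart p).target)) {η : ℝ} (hη : 0 ≤ η)
    (hηS : ∀ s ∈ Icc 0 T, ∀ y ∈ closedBall (0 : E') (4 * P.r p), ‖S s y - 1‖ ≤ η) :
    ∃ A₂ A₃ A₄ : ℝ≥0∞, A₂ ≠ ⊤ ∧ A₃ ≠ ⊤ ∧ A₄ ≠ ⊤ ∧ ∀ {v g : ℝ → M → F'},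
      (∀ q, ContDiffOn ℝ ∞ (uncurry fun s y ↦ v s ((P.chart q).inv y)) (Icc 0 T ×ˢ (P.chart q).target)) →
      ContDiffOn ℝ ∞ (uncurry fun s y ↦ g s ((P.chart p).inv y)) (Icc 0 T ×ˢ (P.chart p).target) →
      (∀ s ∈ Icc 0 T, ∀ y ∈ (P.chart p).target,
        timeDerivWithin (Icc 0 T) (fun s y ↦ v s ((P.chart p).inv y)) s y =
          frameOp (S s y) (𝔟 s y) (𝔠 s y) (fun y ↦ v s ((P.chart p).inv y)) y + g s ((P.chart p).inv y)) →
      ∀ s ∈ Icc 0 T,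
        sobolevEnergy i (slabResidual 1 T (fun s ↦ cutExpr P p (v s)) s) ≤
          ENNReal.ofReal (4 * (Module.finrank ℝ E' : ℝ) ^ 2 * η ^ 2) * ∑ k, ∑ l,
              sobolevEnergy i (fun y ↦ fderiv ℝ (fun z ↦ fderiv ℝ (cutExpr P p (v s)) z
                (stdOrthonormalBasis ℝ E' l)) y (stdOrthonormalBasis ℝ E' k)) +
          A₂ * ∑ l, sobolevEnergy i (fun y ↦ fderiv ℝ (cutExpr P p (v s)) y (stdOrthonormalBasis ℝ E' l)) +
          A₃ * ∑ q, (sobolevEnergy i (cutExpr P q (v s)) +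
            ∑ m, sobolevEnergy i (fun y ↦ fderiv ℝ (cutExpr P q (v s)) y (stdOrthonormalBasis ℝ E' m))) +
          A₄ * sobolevEnergy i (cutExpr P p (g s)) := by
  classical
  obtain ⟨Csh, Clow, Cg, hCshtop, hClowtop, hCgtop, hres⟩ :=
    sobolevEnergy_residual_le (F' := F') P p i one_pos le_rfl
  obtain ⟨Mc, hMc0, hMc⟩ := exists_coeff_bound (F' := F') P hT p i hS h𝔟 h𝔠
  set N2 : ℝ≥0∞ := ((Module.finrank ℝ E' * Module.finrank ℝ E' : ℕ) : ℝ≥0∞) with hN2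
  refine ⟨2 * N2 * (Module.finrank ℝ E' : ℝ≥0∞) * Csh * ENNReal.ofReal (Mc ^ 2),
    2 * Clow * ENNReal.ofReal (Mc ^ 2 + 1), 2 * Cg, ?_, ?_, ?_, ?_⟩
  · exact ENNReal.mul_ne_top (ENNReal.mul_ne_top (ENNReal.mul_ne_top (ENNReal.mul_ne_top (by norm_num)
      (ENNReal.natCast_ne_top _)) (ENNReal.natCast_ne_top _)) hCshtop) ENNReal.ofReal_ne_top
  · exact ENNReal.mul_ne_top (ENNReal.mul_ne_top (by norm_num) hClowtop) ENNReal.ofReal_ne_top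
  · exact ENNReal.mul_ne_top (by norm_num) hCgtop
  intro v g hv hg hpde s hs
  -- the slice data
  have hslice : ∀ {G : ℝ → E' → F'} {V : Set E'}, ContDiffOn ℝ ∞ (uncurry G) (Icc 0 T ×ˢ V) →
      ContDiffOn ℝ ∞ (G s) V := fun {G V} hG ↦
    hG.comp (contDiff_const.prodMk contDiff_id).contDiffOn fun y hy ↦ mk_mem_prod hs hy
  have hf : ∀ q, ContDiffOn ℝ ∞ (v s ∘ (P.chart q).inv) (P.chart q).target := fun q ↦ hslice (hv q)
  have hg' : ContDiffOn ℝ ∞ (g s ∘ (P.chart p).inv) (P.chart p).target := hslice hg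
  have hcu := contDiff_timeDerivWithin_cutExpr P hT p (hv p) hs
  have ha : ∀ k l, ContDiff ℝ ∞ (topCoeff P p (S s) k l) := fun k l ↦
    (isSmoothSpaceTimeOn_topCoeff P p hS k l).contDiff_slice hs
  have hBf : ∀ l, ContDiff ℝ ∞ (firstCoeff P p (𝔟 s) l) := fun l ↦
    (isSmoothSpaceTimeOn_firstCoeff P p h𝔟 l).contDiff_slice hs
  have hCf : ContDiff ℝ ∞ (zeroCoeff P p (𝔠 s)) := (isSmoothSpaceTimeOn_zeroCoeff P p h𝔠).contDiff_slice hs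
  have haη : ∀ k l y, |topCoeff P p (S s) k l y| ≤ η := abs_topCoeff_le P p hη (hηS s hs)
  obtain ⟨ha0, haw, hB0, hBw, hC0, hCw⟩ := hMc s hs
  have h := hres hf hg' hcu (fun y hy ↦ hpde s hs y hy) ha hBf hCf haη ha0 haw hB0 hBw hC0 hCw
  rw [slabResidual_cutExpr_eq P p (hv p) hs]
  refine h.trans (le_of_eq ?_)
  -- arithmetic with `ε = 1`
  have h2 : ENNReal.ofReal (1 + 1) = 2 := by norm_num
  have h2' : ENNReal.ofReal (1 + 1⁻¹) = 2 := by norm_num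
  rw [h2, h2']
  have key : ∀ (A B : ℝ≥0∞) (a : Fin (Module.finrank ℝ E') → Fin (Module.finrank ℝ E') → ℝ≥0∞)
      (c : Fin (Module.finrank ℝ E') → ℝ≥0∞),
      ∑ k, ∑ l, (A * a k l + B * c l) = A * ∑ k, ∑ l, a k l + (Module.finrank ℝ E' : ℝ≥0∞) * B * ∑ l, c l := by
    intro A B a c
    simp only [Finset.sum_add_distrib, Finset.mul_sum]
    congr 1
    simp only [Finset.sum_const, Finset.card_univ, Fintype.card_fin, nsmul_eq_mul]
    rw [Finset.mul_sum]
    refine Finset.sum_congr rfl fun l _ ↦ ?_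
    ring
  rw [key]
  have hη2 : ENNReal.ofReal (4 * (Module.finrank ℝ E' : ℝ) ^ 2 * η ^ 2) =
      2 * N2 * (2 * ENNReal.ofReal (η ^ 2)) := by
    rw [hN2, show (4 * (Module.finrank ℝ E' : ℝ) ^ 2 * η ^ 2) = (2 * ((Module.finrank ℝ E' *
      Module.finrank ℝ E' : ℕ) : ℝ)) * (2 * η ^ 2) by push_cast; ring]
    rw [ENNReal.ofReal_mul (by positivity), ENNReal.ofReal_mul (by norm_num),
      ENNReal.ofReal_mul (by norm_num), ENNReal.ofReal_natCast]
    norm_num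
  rw [hη2]
  ring

end PerTime

/-! ### The a priori estimate -/

section Main

variable [IsManifold I ∞ M] [I.Boundaryless] [T2Space M] [MeasurableSpace E'] [BorelSpace E']
  [FiniteDimensional ℝ F'] {T : ℝ}

/-- **The linear a priori estimate on a closed manifold (residual form).** Given a patch system,
slab-smooth coefficient fields with symbol within `η` of the identity on each patch,
`16 n³ η² ≤ 1`, and an order `i`, there are `Λ > 0` and `C < ∞` such that for every `λ ≥ Λ`,
every `v` (with `v(0) = 0`) and `g` with slab-smooth chart expressions satisfying the chart form
of the linear system `∂ₜv̂_p = frameOp (S p) (𝔟 p) (𝔠 p) v̂_p + ĝ_p` on every patch, and every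
`t ∈ [0, T]`:
`Σ_p ∫₀ᵗ e^{-2λs} E_i(∂ₜw_p - Δw_p) ≤ C Σ_p ∫₀ᵗ e^{-2λs} E_i(cutExpr P p (g s))`,
`w_p = cutExpr P p (v ·)`. [cite: Evans2010, §7.1.3] -/
theorem linear_apriori_residual_le (hT : 0 < T) (i : ℕ) {S : ι → ℝ → E' → (E' →L[ℝ] E')}
    {𝔟 : ι → ℝ → E' → ((E' →L[ℝ] F') →L[ℝ] F')} {𝔠 : ι → ℝ → E' → (F' →L[ℝ] F')}
    (hS : ∀ p, ContDiffOn ℝ ∞ (uncurry (S p)) (Icc 0 T ×ˢ (P.chart p).target))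
    (h𝔟 : ∀ p, ContDiffOn ℝ ∞ (uncurry (𝔟 p)) (Icc 0 T ×ˢ (P.chart p).target))
    (h𝔠 : ∀ p, ContDiffOn ℝ ∞ (uncurry (𝔠 p)) (Icc 0 T ×ˢ (P.chart p).target)) {η : ℝ} (hη : 0 ≤ η)
    (hηS : ∀ p, ∀ s ∈ Icc 0 T, ∀ y ∈ closedBall (0 : E') (4 * P.r p), ‖S p s y - 1‖ ≤ η)
    (hsmall : 16 * (Module.finrank ℝ E' : ℝ) ^ 3 * η ^ 2 ≤ 1) :
    ∃ Λ : ℝ, 0 < Λ ∧ ∃ C : ℝ≥0∞, C ≠ ⊤ ∧ ∀ {lam : ℝ}, Λ ≤ lam → ∀ {v g : ℝ → M → F'},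
      (∀ p, ContDiffOn ℝ ∞ (uncurry fun s y ↦ v s ((P.chart p).inv y)) (Icc 0 T ×ˢ (P.chart p).target)) →
      (∀ x, v 0 x = 0) →
      (∀ p, ContDiffOn ℝ ∞ (uncurry fun s y ↦ g s ((P.chart p).inv y)) (Icc 0 T ×ˢ (P.chart p).target)) →
      (∀ p, ∀ s ∈ Icc 0 T, ∀ y ∈ (P.chart p).target,
        timeDerivWithin (Icc 0 T) (fun s y ↦ v s ((P.chart p).inv y)) s y =
          frameOp (S p s y) (𝔟 p s y) (𝔠 p s y) (fun y ↦ v s ((P.chart p).inv y)) y +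
            g s ((P.chart p).inv y)) →
      ∀ t ∈ Icc 0 T,
        ∑ p, ∫⁻ s in Ioo 0 t, ENNReal.ofReal (Real.exp (-2 * lam * s)) *
            sobolevEnergy i (slabResidual 1 T (fun s ↦ cutExpr P p (v s)) s) ≤
          C * ∑ p, ∫⁻ s in Ioo 0 t, ENNReal.ofReal (Real.exp (-2 * lam * s)) *
            sobolevEnergy i (cutExpr P p (g s)) := by
  classical
  -- per-patch constants of the per-time inequality
  have hp : ∀ p, ∃ A₂ A₃ A₄ : ℝ≥0∞, A₂ ≠ ⊤ ∧ A₃ ≠ ⊤ ∧ A₄ ≠ ⊤ ∧ ∀ {v g : ℝ → M → F'},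
      (∀ q, ContDiffOn ℝ ∞ (uncurry fun s y ↦ v s ((P.chart q).inv y)) (Icc 0 T ×ˢ (P.chart q).target)) →
      ContDiffOn ℝ ∞ (uncurry fun s y ↦ g s ((P.chart p).inv y)) (Icc 0 T ×ˢ (P.chart p).target) →
      (∀ s ∈ Icc 0 T, ∀ y ∈ (P.chart p).target,
        timeDerivWithin (Icc 0 T) (fun s y ↦ v s ((P.chart p).inv y)) s y =
          frameOp (S p s y) (𝔟 p s y) (𝔠 p s y) (fun y ↦ v s ((P.chart p).inv y)) y + g s ((P.chart p).inv y)) →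
      ∀ s ∈ Icc 0 T,
        sobolevEnergy i (slabResidual 1 T (fun s ↦ cutExpr P p (v s)) s) ≤
          ENNReal.ofReal (4 * (Module.finrank ℝ E' : ℝ) ^ 2 * η ^ 2) * ∑ k, ∑ l,
              sobolevEnergy i (fun y ↦ fderiv ℝ (fun z ↦ fderiv ℝ (cutExpr P p (v s)) z
                (stdOrthonormalBasis ℝ E' l)) y (stdOrthonormalBasis ℝ E' k)) +
          A₂ * ∑ l, sobolevEnergy i (fun y ↦ fderiv ℝ (cutExpr P p (v s)) y (stdOrthonormalBasis ℝ E' l)) +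
          A₃ * ∑ q, (sobolevEnergy i (cutExpr P q (v s)) +
            ∑ m, sobolevEnergy i (fun y ↦ fderiv ℝ (cutExpr P q (v s)) y (stdOrthonormalBasis ℝ E' m))) +
          A₄ * sobolevEnergy i (cutExpr P p (g s)) := fun p ↦
    sobolevEnergy_slabResidual_le P hT p i (hS p) (h𝔟 p) (h𝔠 p) hη (hηS p)
  choose A₂ A₃ A₄ hA₂ hA₃ hA₄ hineq using hp
  set a₂ : ℝ≥0∞ := ∑ p, A₂ p with ha₂
  set a₃ : ℝ≥0∞ := ∑ p, A₃ p with ha₃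
  set a₄ : ℝ≥0∞ := ∑ p, A₄ p with ha₄
  have ha₂top : a₂ ≠ ⊤ := ENNReal.sum_ne_top.2 fun p _ ↦ hA₂ p
  have ha₃top : a₃ ≠ ⊤ := ENNReal.sum_ne_top.2 fun p _ ↦ hA₃ p
  have ha₄top : a₄ ≠ ⊤ := ENNReal.sum_ne_top.2 fun p _ ↦ hA₄ p
  have hA₂le : ∀ p, A₂ p ≤ a₂ := fun p ↦ Finset.single_le_sum (f := A₂) (fun _ _ ↦ bot_le) (Finset.mem_univ p)
  have hA₄le : ∀ p, A₄ p ≤ a₄ := fun p ↦ Finset.single_le_sum (f := A₄) (fun _ _ ↦ bot_le) (Finset.mem_univ p)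
  -- the threshold `Λ`
  set Kc : ℝ≥0∞ := a₂ + 2 * a₃ with hKc
  have hKctop : Kc ≠ ⊤ := ENNReal.add_ne_top.2 ⟨ha₂top, ENNReal.mul_ne_top (by norm_num) ha₃top⟩
  refine ⟨max 1 (4 * Kc.toReal), lt_max_of_lt_left one_pos, 2 * a₄, ENNReal.mul_ne_top (by norm_num) ha₄top, ?_⟩
  intro lam hlam v g hv hv0 hg hpde t ht
  have hlam1 : 1 ≤ lam := (le_max_left _ _).trans hlam
  have hlam0 : 0 < lam := one_pos.trans_le hlam1
  have hlamK : 4 * Kc.toReal ≤ lam := (le_max_right _ _).trans hlam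
  -- notation for the weighted integrals
  set W : ℝ → ℝ≥0∞ := fun s ↦ ENNReal.ofReal (Real.exp (-2 * lam * s)) with hW
  have hWm : Measurable W := (Real.continuous_exp.comp (continuous_const.mul continuous_id)).measurable.ennreal_ofReal
  set w : ι → ℝ → E' → F' := fun p s ↦ cutExpr P p (v s) with hw
  -- the families `w p` satisfy the hypotheses of the engine
  have hws : ∀ p, IsSmoothSpaceTimeOn (Icc 0 T) (w p) := fun p ↦ isSmoothSpaceTimeOn_cutExpr P p (hv p)
  have hKp : ∀ p, IsCompact (closedBall (0 : E') (3 * P.r p)) := fun p ↦ isCompact_closedBall _ _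
  have hwK : ∀ p s, ∀ y ∉ closedBall (0 : E') (3 * P.r p), w p s y = 0 := fun p s y hy ↦
    cutExpr_family_eq_zero P p s hy
  have hw0 : ∀ p y, w p 0 y = 0 := fun p y ↦ cutExpr_family_zero P p hv0 y
  -- the quantities
  set R : ι → ℝ≥0∞ := fun p ↦ ∫⁻ s in Ioo 0 t, W s * sobolevEnergy i (slabResidual 1 T (w p) s) with hR
  set X : ι → ℝ≥0∞ := fun p ↦ ∫⁻ s in Ioo 0 t, W s * ∑ k, ∑ l, sobolevEnergy i
    (fun y ↦ fderiv ℝ (fun z ↦ fderiv ℝ (w p s) z (stdOrthonormalBasis ℝ E' l)) y (stdOrthonormalBasis ℝ E' k))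
    with hX
  set Y : ι → ℝ≥0∞ := fun p ↦ ∫⁻ s in Ioo 0 t, W s * ∑ l, sobolevEnergy i
    (fun y ↦ fderiv ℝ (w p s) y (stdOrthonormalBasis ℝ E' l)) with hY
  set Z : ι → ℝ≥0∞ := fun p ↦ ∫⁻ s in Ioo 0 t, W s * sobolevEnergy i (w p s) with hZ
  set G : ι → ℝ≥0∞ := fun p ↦ ∫⁻ s in Ioo 0 t, W s * sobolevEnergy i (cutExpr P p (g s)) with hG
  -- the engine bounds
  have hXle : ∀ p, X p ≤ (Module.finrank ℝ E' : ℝ≥0∞) * R p := by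
    intro p
    have h := lintegral_weight_sum_sobolevEnergy_fderiv_fderiv_le_residual hT one_pos (hws p) (hKp p) (hwK p)
      (hw0 p) hlam0.le i ht
    have h1 : ENNReal.ofReal ((Module.finrank ℝ E' : ℝ) / 1 ^ 2) = (Module.finrank ℝ E' : ℝ≥0∞) := by
      rw [one_pow, div_one, ENNReal.ofReal_natCast]
    rw [h1] at h
    refine le_trans (le_of_eq ?_) h
    rw [hX]
    simp only
    refine lintegral_congr fun s ↦ ?_
    rw [Finset.sum_comm]
  have hYle : ∀ p, Y p ≤ ENNReal.ofReal (lam⁻¹ / 2) * R p := by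
    intro p
    have h := lintegral_weight_sum_sobolevEnergy_fderiv_le_residual hT one_pos (hws p) (hKp p) (hwK p)
      (hw0 p) hlam0 i ht
    rwa [mul_one] at h
  have hZle : ∀ p, Z p ≤ ENNReal.ofReal (lam⁻¹ ^ 2) * R p := fun p ↦
    lintegral_weight_sobolevEnergy_le_residual hT one_pos (hws p) (hKp p) (hwK p) (hw0 p) hlam0 i ht
  have hRtop : ∀ p, R p ≠ ⊤ := fun p ↦
    lintegral_weight_sobolevEnergy_slab_ne_top hT (isSmoothSpaceTimeOn_slabResidual hT (hws p)) (hKp p)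
      (fun s y hy ↦ slabResidual_eq_zero (hKp p).isClosed (hwK p) s hy) i hlam0.le ht.2
  -- measurability of the slice energies on `(0, t)`
  have hd1 : ∀ p l, IsSmoothSpaceTimeOn (Icc 0 T) fun s y ↦ fderiv ℝ (w p s) y (stdOrthonormalBasis ℝ E' l) :=
    fun p l ↦ isSmoothSpaceTimeOn_fderiv_apply_Icc hT (hws p) _
  have hd2 : ∀ p k l, IsSmoothSpaceTimeOn (Icc 0 T) fun s y ↦
      fderiv ℝ (fun z ↦ fderiv ℝ (w p s) z (stdOrthonormalBasis ℝ E' l)) y (stdOrthonormalBasis ℝ E' k) :=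
    fun p k l ↦ isSmoothSpaceTimeOn_fderiv_apply_Icc hT (hd1 p l) _
  have mX : ∀ p, AEMeasurable (fun s ↦ ∑ k, ∑ l, sobolevEnergy i (fun y ↦ fderiv ℝ
      (fun z ↦ fderiv ℝ (w p s) z (stdOrthonormalBasis ℝ E' l)) y (stdOrthonormalBasis ℝ E' k)))
      (volume.restrict (Ioo 0 t)) := fun p ↦
    Finset.aemeasurable_fun_sum _ fun k _ ↦ Finset.aemeasurable_fun_sum _ fun l _ ↦
      aemeasurable_sobolevEnergy_slice isOpen_Ioo i ((hd2 p k l).mono fun _ hs ↦ ⟨hs.1.le, hs.2.le.trans ht.2⟩)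
  have mY : ∀ p, AEMeasurable (fun s ↦ ∑ l, sobolevEnergy i (fun y ↦ fderiv ℝ (w p s) y
      (stdOrthonormalBasis ℝ E' l))) (volume.restrict (Ioo 0 t)) := fun p ↦
    Finset.aemeasurable_fun_sum _ fun l _ ↦ aemeasurable_sobolevEnergy_slice isOpen_Ioo i ((hd1 p l).mono fun _ hs ↦ ⟨hs.1.le, hs.2.le.trans ht.2⟩)
  have mZ : ∀ p, AEMeasurable (fun s ↦ sobolevEnergy i (w p s)) (volume.restrict (Ioo 0 t)) := fun p ↦
    aemeasurable_sobolevEnergy_slice isOpen_Ioo i ((hws p).mono fun _ hs ↦ ⟨hs.1.le, hs.2.le.trans ht.2⟩)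
  have mG : ∀ p, AEMeasurable (fun s ↦ sobolevEnergy i (cutExpr P p (g s))) (volume.restrict (Ioo 0 t)) :=
    fun p ↦ aemeasurable_sobolevEnergy_slice isOpen_Ioo i ((isSmoothSpaceTimeOn_cutExpr P p (hg p)).mono fun _ hs ↦ ⟨hs.1.le, hs.2.le.trans ht.2⟩)
  have hWm' : AEMeasurable W (volume.restrict (Ioo 0 t)) := hWm.aemeasurable
  -- Step 1: integrate the per-time inequality
  set c₁ : ℝ≥0∞ := ENNReal.ofReal (4 * (Module.finrank ℝ E' : ℝ) ^ 2 * η ^ 2) with hc₁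
  have hRle : ∀ p, R p ≤ c₁ * X p + A₂ p * Y p + A₃ p * ∑ q, (Z q + Y q) + A₄ p * G p := by
    intro p
    have hpt : ∀ s ∈ Ioo 0 t, W s * sobolevEnergy i (slabResidual 1 T (w p) s) ≤
        W s * (c₁ * ∑ k, ∑ l, sobolevEnergy i (fun y ↦ fderiv ℝ
          (fun z ↦ fderiv ℝ (w p s) z (stdOrthonormalBasis ℝ E' l)) y (stdOrthonormalBasis ℝ E' k))) +
        W s * (A₂ p * ∑ l, sobolevEnergy i (fun y ↦ fderiv ℝ (w p s) y (stdOrthonormalBasis ℝ E' l))) +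
        W s * (A₃ p * ∑ q, (sobolevEnergy i (w q s) +
          ∑ m, sobolevEnergy i (fun y ↦ fderiv ℝ (w q s) y (stdOrthonormalBasis ℝ E' m)))) +
        W s * (A₄ p * sobolevEnergy i (cutExpr P p (g s))) := by
      intro s hs
      have hs' : s ∈ Icc 0 T := ⟨hs.1.le, hs.2.le.trans ht.2⟩
      have h := hineq p hv (hg p) (hpde p) s hs'
      calc W s * sobolevEnergy i (slabResidual 1 T (w p) s)
          ≤ W s * (c₁ * ∑ k, ∑ l, sobolevEnergy i (fun y ↦ fderiv ℝ
              (fun z ↦ fderiv ℝ (w p s) z (stdOrthonormalBasis ℝ E' l)) y (stdOrthonormalBasis ℝ E' k)) +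
            A₂ p * ∑ l, sobolevEnergy i (fun y ↦ fderiv ℝ (w p s) y (stdOrthonormalBasis ℝ E' l)) +
            A₃ p * ∑ q, (sobolevEnergy i (w q s) +
              ∑ m, sobolevEnergy i (fun y ↦ fderiv ℝ (w q s) y (stdOrthonormalBasis ℝ E' m))) +
            A₄ p * sobolevEnergy i (cutExpr P p (g s))) := mul_le_mul' le_rfl h
        _ = _ := by ring
    calc R p ≤ ∫⁻ s in Ioo 0 t, (W s * (c₁ * ∑ k, ∑ l, sobolevEnergy i (fun y ↦ fderiv ℝ
          (fun z ↦ fderiv ℝ (w p s) z (stdOrthonormalBasis ℝ E' l)) y (stdOrthonormalBasis ℝ E' k))) +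
        W s * (A₂ p * ∑ l, sobolevEnergy i (fun y ↦ fderiv ℝ (w p s) y (stdOrthonormalBasis ℝ E' l))) +
        W s * (A₃ p * ∑ q, (sobolevEnergy i (w q s) +
          ∑ m, sobolevEnergy i (fun y ↦ fderiv ℝ (w q s) y (stdOrthonormalBasis ℝ E' m)))) +
        W s * (A₄ p * sobolevEnergy i (cutExpr P p (g s)))) := setLIntegral_mono' measurableSet_Ioo hpt
      _ = c₁ * X p + A₂ p * Y p + A₃ p * ∑ q, (Z q + Y q) + A₄ p * G p := by
        have m1 : AEMeasurable (fun s ↦ W s * (c₁ * ∑ k, ∑ l, sobolevEnergy i (fun y ↦ fderiv ℝ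
            (fun z ↦ fderiv ℝ (w p s) z (stdOrthonormalBasis ℝ E' l)) y (stdOrthonormalBasis ℝ E' k))))
            (volume.restrict (Ioo 0 t)) := hWm'.mul ((mX p).const_mul _)
        have m2 : AEMeasurable (fun s ↦ W s * (A₂ p * ∑ l, sobolevEnergy i (fun y ↦ fderiv ℝ (w p s) y
            (stdOrthonormalBasis ℝ E' l)))) (volume.restrict (Ioo 0 t)) := hWm'.mul ((mY p).const_mul _)
        have mq : AEMeasurable (fun s ↦ ∑ q, (sobolevEnergy i (w q s) +
            ∑ m, sobolevEnergy i (fun y ↦ fderiv ℝ (w q s) y (stdOrthonormalBasis ℝ E' m))))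
            (volume.restrict (Ioo 0 t)) :=
          Finset.aemeasurable_fun_sum _ fun q _ ↦ (mZ q).add (mY q)
        have m3 : AEMeasurable (fun s ↦ W s * (A₃ p * ∑ q, (sobolevEnergy i (w q s) +
            ∑ m, sobolevEnergy i (fun y ↦ fderiv ℝ (w q s) y (stdOrthonormalBasis ℝ E' m)))))
            (volume.restrict (Ioo 0 t)) := hWm'.mul (mq.const_mul _)
        have m12 : AEMeasurable (fun s ↦ W s * (c₁ * ∑ k, ∑ l, sobolevEnergy i (fun y ↦ fderiv ℝ
            (fun z ↦ fderiv ℝ (w p s) z (stdOrthonormalBasis ℝ E' l)) y (stdOrthonormalBasis ℝ E' k))) +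
            W s * (A₂ p * ∑ l, sobolevEnergy i (fun y ↦ fderiv ℝ (w p s) y (stdOrthonormalBasis ℝ E' l))))
            (volume.restrict (Ioo 0 t)) := m1.add m2
        have m123 : AEMeasurable (fun s ↦ W s * (c₁ * ∑ k, ∑ l, sobolevEnergy i (fun y ↦ fderiv ℝ
            (fun z ↦ fderiv ℝ (w p s) z (stdOrthonormalBasis ℝ E' l)) y (stdOrthonormalBasis ℝ E' k))) +
            W s * (A₂ p * ∑ l, sobolevEnergy i (fun y ↦ fderiv ℝ (w p s) y (stdOrthonormalBasis ℝ E' l))) +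
            W s * (A₃ p * ∑ q, (sobolevEnergy i (w q s) +
              ∑ m, sobolevEnergy i (fun y ↦ fderiv ℝ (w q s) y (stdOrthonormalBasis ℝ E' m)))))
            (volume.restrict (Ioo 0 t)) := m12.add m3
        rw [lintegral_add_left' m123, lintegral_add_left' m12, lintegral_add_left' m1]
        -- each piece (measurability facts in lambda form)
        have mWX : AEMeasurable (fun s ↦ W s * ∑ k, ∑ l, sobolevEnergy i (fun y ↦ fderiv ℝ
            (fun z ↦ fderiv ℝ (w p s) z (stdOrthonormalBasis ℝ E' l)) y (stdOrthonormalBasis ℝ E' k)))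
            (volume.restrict (Ioo 0 t)) := hWm'.mul (mX p)
        have mWY : ∀ q, AEMeasurable (fun s ↦ W s * ∑ l, sobolevEnergy i (fun y ↦ fderiv ℝ (w q s) y
            (stdOrthonormalBasis ℝ E' l))) (volume.restrict (Ioo 0 t)) := fun q ↦ hWm'.mul (mY q)
        have mWZ : ∀ q, AEMeasurable (fun s ↦ W s * sobolevEnergy i (w q s)) (volume.restrict (Ioo 0 t)) :=
          fun q ↦ hWm'.mul (mZ q)
        have mWG : AEMeasurable (fun s ↦ W s * sobolevEnergy i (cutExpr P p (g s))) (volume.restrict (Ioo 0 t)) :=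
          hWm'.mul (mG p)
        have e1 : ∫⁻ s in Ioo 0 t, W s * (c₁ * ∑ k, ∑ l, sobolevEnergy i (fun y ↦ fderiv ℝ
            (fun z ↦ fderiv ℝ (w p s) z (stdOrthonormalBasis ℝ E' l)) y (stdOrthonormalBasis ℝ E' k))) =
            c₁ * X p := by
          calc _ = ∫⁻ s in Ioo 0 t, c₁ * (W s * ∑ k, ∑ l, sobolevEnergy i (fun y ↦ fderiv ℝ
                (fun z ↦ fderiv ℝ (w p s) z (stdOrthonormalBasis ℝ E' l)) y (stdOrthonormalBasis ℝ E' k))) :=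
                lintegral_congr fun s ↦ by ring
            _ = c₁ * X p := lintegral_const_mul'' c₁ mWX
        have e2 : ∫⁻ s in Ioo 0 t, W s * (A₂ p * ∑ l, sobolevEnergy i (fun y ↦ fderiv ℝ (w p s) y
            (stdOrthonormalBasis ℝ E' l))) = A₂ p * Y p := by
          calc _ = ∫⁻ s in Ioo 0 t, A₂ p * (W s * ∑ l, sobolevEnergy i (fun y ↦ fderiv ℝ (w p s) y
              (stdOrthonormalBasis ℝ E' l))) := lintegral_congr fun s ↦ by ring
            _ = A₂ p * Y p := lintegral_const_mul'' (A₂ p) (mWY p)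
        have e3 : ∫⁻ s in Ioo 0 t, W s * (A₃ p * ∑ q, (sobolevEnergy i (w q s) +
            ∑ m, sobolevEnergy i (fun y ↦ fderiv ℝ (w q s) y (stdOrthonormalBasis ℝ E' m)))) =
            A₃ p * ∑ q, (Z q + Y q) := by
          have mqq : ∀ q, AEMeasurable (fun s ↦ W s * sobolevEnergy i (w q s) +
              W s * ∑ m, sobolevEnergy i (fun y ↦ fderiv ℝ (w q s) y (stdOrthonormalBasis ℝ E' m)))
              (volume.restrict (Ioo 0 t)) := fun q ↦ (mWZ q).add (mWY q)
          have mq' : AEMeasurable (fun s ↦ ∑ q, (W s * sobolevEnergy i (w q s) +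
              W s * ∑ m, sobolevEnergy i (fun y ↦ fderiv ℝ (w q s) y (stdOrthonormalBasis ℝ E' m))))
              (volume.restrict (Ioo 0 t)) := Finset.aemeasurable_fun_sum _ fun q _ ↦ mqq q
          calc _ = ∫⁻ s in Ioo 0 t, A₃ p * ∑ q, (W s * sobolevEnergy i (w q s) +
                W s * ∑ m, sobolevEnergy i (fun y ↦ fderiv ℝ (w q s) y (stdOrthonormalBasis ℝ E' m))) := by
                refine lintegral_congr fun s ↦ ?_
                rw [Finset.mul_sum, Finset.mul_sum, Finset.mul_sum]
                refine Finset.sum_congr rfl fun q _ ↦ ?_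
                ring
            _ = A₃ p * ∫⁻ s in Ioo 0 t, ∑ q, (W s * sobolevEnergy i (w q s) +
                W s * ∑ m, sobolevEnergy i (fun y ↦ fderiv ℝ (w q s) y (stdOrthonormalBasis ℝ E' m))) :=
                lintegral_const_mul'' (A₃ p) mq'
            _ = A₃ p * ∑ q, ∫⁻ s in Ioo 0 t, (W s * sobolevEnergy i (w q s) +
                W s * ∑ m, sobolevEnergy i (fun y ↦ fderiv ℝ (w q s) y (stdOrthonormalBasis ℝ E' m))) := by
                rw [lintegral_finsetSum' _ fun q _ ↦ mqq q]
            _ = A₃ p * ∑ q, (Z q + Y q) := by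
                congr 1
                refine Finset.sum_congr rfl fun q _ ↦ ?_
                rw [lintegral_add_left' (mWZ q)]
        have e4 : ∫⁻ s in Ioo 0 t, W s * (A₄ p * sobolevEnergy i (cutExpr P p (g s))) = A₄ p * G p := by
          calc _ = ∫⁻ s in Ioo 0 t, A₄ p * (W s * sobolevEnergy i (cutExpr P p (g s))) :=
                lintegral_congr fun s ↦ by ring
            _ = A₄ p * G p := lintegral_const_mul'' (A₄ p) mWG
        rw [e1, e2, e3, e4]
  -- Step 2: sum over the patches and absorb
  set Rt : ℝ≥0∞ := ∑ p, R p with hRt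
  set Gt : ℝ≥0∞ := ∑ p, G p with hGt
  have hRttop : Rt ≠ ⊤ := ENNReal.sum_ne_top.2 fun p _ ↦ hRtop p
  have hYR : ∑ p, Y p ≤ ENNReal.ofReal (lam⁻¹ / 2) * Rt := by
    rw [hRt, Finset.mul_sum]; exact Finset.sum_le_sum fun p _ ↦ hYle p
  have hZR : ∑ p, Z p ≤ ENNReal.ofReal (lam⁻¹ ^ 2) * Rt := by
    rw [hRt, Finset.mul_sum]; exact Finset.sum_le_sum fun p _ ↦ hZle p
  have hXR : ∑ p, X p ≤ (Module.finrank ℝ E' : ℝ≥0∞) * Rt := by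
    rw [hRt, Finset.mul_sum]; exact Finset.sum_le_sum fun p _ ↦ hXle p
  -- smallness of the coefficients
  have hc₁n : c₁ * (Module.finrank ℝ E' : ℝ≥0∞) ≤ 4⁻¹ := by
    rw [hc₁, ← ENNReal.ofReal_natCast, ← ENNReal.ofReal_mul (by positivity)]
    have h : 4 * (Module.finrank ℝ E' : ℝ) ^ 2 * η ^ 2 * (Module.finrank ℝ E' : ℝ) ≤ 4⁻¹ := by nlinarith
    refine (ENNReal.ofReal_le_ofReal h).trans ?_
    rw [ENNReal.ofReal_inv_of_pos (by norm_num)]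
    norm_num
  have hlamc : a₂ * ENNReal.ofReal (lam⁻¹ / 2) + a₃ * (ENNReal.ofReal (lam⁻¹ ^ 2) + ENNReal.ofReal (lam⁻¹ / 2)) ≤
      4⁻¹ := by
    have hl1 : ENNReal.ofReal (lam⁻¹ / 2) ≤ ENNReal.ofReal lam⁻¹ :=
      ENNReal.ofReal_le_ofReal (by linarith [inv_nonneg.2 hlam0.le])
    have hl2 : ENNReal.ofReal (lam⁻¹ ^ 2) ≤ ENNReal.ofReal lam⁻¹ := by
      refine ENNReal.ofReal_le_ofReal ?_
      have h1 : lam⁻¹ ≤ 1 := inv_le_one_of_one_le₀ hlam1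
      nlinarith [inv_nonneg.2 hlam0.le]
    calc a₂ * ENNReal.ofReal (lam⁻¹ / 2) + a₃ * (ENNReal.ofReal (lam⁻¹ ^ 2) + ENNReal.ofReal (lam⁻¹ / 2))
        ≤ a₂ * ENNReal.ofReal lam⁻¹ + a₃ * (ENNReal.ofReal lam⁻¹ + ENNReal.ofReal lam⁻¹) := by gcongr
      _ = ENNReal.ofReal lam⁻¹ * Kc := by rw [hKc]; ring
      _ = ENNReal.ofReal lam⁻¹ * ENNReal.ofReal Kc.toReal := by rw [ENNReal.ofReal_toReal hKctop]
      _ = ENNReal.ofReal (lam⁻¹ * Kc.toReal) := by rw [ENNReal.ofReal_mul (inv_nonneg.2 hlam0.le)]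
      _ ≤ ENNReal.ofReal 4⁻¹ := by
          refine ENNReal.ofReal_le_ofReal ?_
          rw [inv_mul_le_iff₀ hlam0]
          linarith [ENNReal.toReal_nonneg (a := Kc)]
      _ = 4⁻¹ := by rw [ENNReal.ofReal_inv_of_pos (by norm_num)]; norm_num
  -- the summed inequality
  have hsum : Rt ≤ 2⁻¹ * Rt + a₄ * Gt := by
    calc Rt = ∑ p, R p := hRt
      _ ≤ ∑ p, (c₁ * X p + A₂ p * Y p + A₃ p * ∑ q, (Z q + Y q) + A₄ p * G p) :=
          Finset.sum_le_sum fun p _ ↦ hRle p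
      _ = c₁ * ∑ p, X p + ∑ p, A₂ p * Y p + a₃ * ∑ q, (Z q + Y q) + ∑ p, A₄ p * G p := by
          rw [ha₃]
          simp only [Finset.sum_add_distrib, Finset.mul_sum, Finset.sum_mul]
      _ ≤ c₁ * ((Module.finrank ℝ E' : ℝ≥0∞) * Rt) + a₂ * ∑ p, Y p +
          a₃ * (∑ q, Z q + ∑ q, Y q) + a₄ * Gt := by
          refine add_le_add (add_le_add (add_le_add ?_ ?_) (le_of_eq ?_)) ?_
          · exact mul_le_mul' le_rfl hXR
          · rw [Finset.mul_sum]; exact Finset.sum_le_sum fun p _ ↦ mul_le_mul' (hA₂le p) le_rfl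
          · rw [Finset.sum_add_distrib]
          · rw [hGt, Finset.mul_sum]; exact Finset.sum_le_sum fun p _ ↦ mul_le_mul' (hA₄le p) le_rfl
      _ ≤ c₁ * ((Module.finrank ℝ E' : ℝ≥0∞) * Rt) + a₂ * (ENNReal.ofReal (lam⁻¹ / 2) * Rt) +
          a₃ * (ENNReal.ofReal (lam⁻¹ ^ 2) * Rt + ENNReal.ofReal (lam⁻¹ / 2) * Rt) + a₄ * Gt := by
          gcongr
      _ = (c₁ * (Module.finrank ℝ E' : ℝ≥0∞) + (a₂ * ENNReal.ofReal (lam⁻¹ / 2) +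
          a₃ * (ENNReal.ofReal (lam⁻¹ ^ 2) + ENNReal.ofReal (lam⁻¹ / 2)))) * Rt + a₄ * Gt := by ring
      _ ≤ (4⁻¹ + 4⁻¹) * Rt + a₄ * Gt := by gcongr
      _ = 2⁻¹ * Rt + a₄ * Gt := by
          have hq : (4⁻¹ : ℝ≥0∞) + 4⁻¹ = 2⁻¹ := by
            rw [← ENNReal.ofReal_ofNat 4, ← ENNReal.ofReal_ofNat 2,
              ← ENNReal.ofReal_inv_of_pos (by norm_num), ← ENNReal.ofReal_inv_of_pos (by norm_num),
              ← ENNReal.ofReal_add (by norm_num) (by norm_num)]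
            norm_num
          rw [hq]
  have hfin := ENNReal.le_of_le_half_mul_add hRttop hsum
  calc ∑ p, ∫⁻ s in Ioo 0 t, W s * sobolevEnergy i (slabResidual 1 T (fun s ↦ cutExpr P p (v s)) s)
      = Rt := by rw [hRt]
    _ ≤ 2 * (a₄ * Gt) := hfin
    _ = 2 * a₄ * ∑ p, ∫⁻ s in Ioo 0 t, W s * sobolevEnergy i (cutExpr P p (g s)) := by rw [hGt, mul_assoc]

end Main

end PatchSystemLoc

end Literature.Analysis.PDE

end
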